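import Mathlib
import HarnessLib
import Summits.Ventures.LatticeQCDFlow.Exactness.WilsonUniformJitterHMC
import Summits.Ventures.LatticeQCDFlow.Exactness.NCMCGeneralSpaceDoeblinPowerCLT
import Summits.Ventures.LatticeQCDFlow.Scoring.DoeblinPowerBatchMeansCLT
import Summits.Ventures.LatticeQCDFlow.Scoring.DoeblinPowerBatchMeansTauInt
import Summits.Ventures.LatticeQCDFlow.Scoring.BatchMeansTauIntCLT
import Summits.Ventures.LatticeQCDFlow.Scoring.AsymptoticCoverage
import Summits.Ventures.LatticeQCDFlow.Scoring.DoeblinPowerGeometricEnvelope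

/-!
# The error bars of a run of the engine's jittered `SU(N)` HMC AS RUN with the uniform (atomless) `tau_jitter` law: CLT for time averages, consistent batch-means `σ̂²`, asymptotically exact coverage, consistent `τ̂_int` — from EVERY start whenever `τ(1 − j) < τ₀`

HONEST FRAMING: exact (Metropolis-corrected) sampling algorithms for lattice gauge theory;
figures of merit are autocorrelation/cost numbers at stated couplings and volumes; no
continuum-physics claim.

Venture `LatticeQCDFlow` (cell pub-lqcd), topic `Exactness`, FANOUT row 9 (eng-latcore, GEN-24; the engine
`latflow.core.hmc.HMC(f, β, 'leapfrog').trajectory(τ, nstep, tau_jitter = j)` — length `τ(1 + j(2u − 1))`,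
`u ∼ U(0,1)` — reported with batch-means / Γ-method error bars by the HMC arms).  NEW WORK of the cell over GEN-24's
`WilsonUniformJitterHMC.lean` (`uniformJitterLaw`, `wilson_uniformJitterHMC_invariant`, `wilson_uniformJitterHMC_certificate`,
`wilson_uniformJitterHMC_exactStep_certificate`), row 13's `NCMCGeneralSpaceDoeblinPowerCLT.lean`
(`tendstoInDistribution_timeAverage_of_nHit`), row 8's `Scoring/DoeblinPowerBatchMeans*.lean`
(`chain_batchMeans_sigmaHat_tendstoInMeasure_of_nHit`, `doeblinPower_batchMeans_studentized_coverage`,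
`chain_batchMeans_tauInt_tendstoInMeasure_of_nHit`).  It is the ATOMLESS twin of GEN-23's
`SUNJitteredHMCErrorBars.lean`, whose shape it repeats word for word: the hypothesis "one atom `l₀` of the jitter
law is short" (constant carrying `η{l₀}`, i.e. `2⁻⁵³` for the code's uniform) becomes the engine's parameters
`nstep ≥ 1`, `τ > 0`, `0 < j ≤ 1`, `τ(1 − j) < τ₀` — e.g. `j = 1` at EVERY production length.  Nothing is cited as a
fact; no number is claimed.  Printed counterparts NAMED ONLY: Kipnis–Varadhan 1986 / Meyn–Tweedie 1993 ch. 17;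
Flegal–Jones 2010; Madras–Sokal 1988 / Wolff 2004.

## Content (`K = wilsonJitterHMCL N d L β nstep (uniformJitterLaw τ j)`, `π = wilsonMeasure (β/N)`; every theorem:
## `∃ τ₀ > 0` on `N, d, L, β` only, then for EVERY `nstep ≥ 1`, `τ > 0`, `0 < j ≤ 1` with `τ(1 − j) < τ₀`, EVERY
## bounded measurable `f`, EVERY initial law `μ₀`; `σ²_f` = the Green–Kubo variance)

* **`wilson_uniformJitterHMC_timeAverage_clt`** — `(√n)⁻¹ Σ_{t<n} (f(U_t) − π f) ⇒ N(0, σ²_f)` under `P_{μ₀}`.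
* **`wilson_uniformJitterHMC_batchMeans_tendstoInMeasure`** — `a b · SE²_BM → σ²_f` in probability (`a, b → ∞`).
* **`wilson_uniformJitterHMC_batchMeans_coverage`** — `σ²_f > 0`, `z > 0`:
  `P_{μ₀}(|√(ab) (f̄ − π f)| ≤ z σ̂_BM) → N(0,1)([−z, z])`.
* **`wilson_uniformJitterHMC_tauInt_tendstoInMeasure`** — `Var_π f ≠ 0`: `τ̂_int = σ̂²_BM/(2 v̂) → τ_int(ρ_f)` in probability.
* **`wilson_uniformJitterHMC_exactStep_timeAverage_clt`**, **`wilson_uniformJitterHMC_exactStep_batchMeans_coverage`** — the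
  same for `P ∘ K` with ANY Markov `P` leaving `π` invariant (`'hmc'(tau_jitter) + n_or × 'or'` as run).
* **`wilson_uniformJitterHMC_tauInt_interval_coverage`**, **`wilson_uniformJitterHMC_exactStep_tauInt_interval_coverage`** —
  ERROR BARS ON THE REPORTED `τ_int`: `τ̂(1 ± z√(2/a))` covers `τ_int` with probability `→ N(0,1)([−z, z])` from every
  start (row 4's studentised `τ̂_int` CLT + row 8's geometric envelope; the twin of GEN-23's `EngineTauIntErrorBars.lean`).

NOT CLAIMED: any rate; `σ²_f > 0` / `Var f ≠ 0` (assumed where stated); unbounded observables; anything when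
`τ(1 − j) ≥ τ₀`; OMF words; floating point.
-/

noncomputable section

namespace Summit.Ventures.LatticeQCDFlow.Exactness

open MeasureTheory ProbabilityTheory ProbabilityTheory.Kernel Set Function Filter Topology
open Literature.MathematicalPhysics.QuantumFieldTheory
open Literature.MathematicalPhysics.QuantumLattice (fundamentalRep continuous_fundamentalRep)
open Summit.Ventures.LatticeQCDFlow.Scoring (replicaSEsq tauInt autocov kop)
open scoped ENNReal Matrix Matrix.Norms.Operator NNReal

set_option backward.isDefEq.respectTransparency false

section ErrorBars

variable {N d L : ℕ} [NeZero N] [NeZero L] (β : ℝ)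

/-- **THE CLT FOR TIME AVERAGES OF THE ENGINE'S JITTERED `SU(N)` HMC AS RUN, FROM EVERY INITIAL LAW, FOR EVERY
`(τ, j)` WITH `τ(1 − j) < τ₀`**: for `|f| ≤ C` measurable and `Y ~ N(0, σ²_f)`:
`(√n)⁻¹ Σ_{t<n} (f(U_t) − π f) ⇒ Y` under `P_{μ₀}` (the path law is a probability law — the bracketed instance
is Mathlib's, spelled out as in row 13's `tendstoInDistribution_timeAverage_of_nHit`). -/
theorem wilson_uniformJitterHMC_timeAverage_clt :
    ∃ τ₀ : ℝ, 0 < τ₀ ∧ ∀ (nstep : ℕ) (τ j : ℝ), 1 ≤ nstep → 0 < τ → 0 < j → j ≤ 1 → τ * (1 - j) < τ₀ →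
      ∀ (f : GaugeConfig d L (Matrix.specialUnitaryGroup (Fin N) ℂ) → ℝ), Measurable f → ∀ C : ℝ, (∀ U, |f U| ≤ C) →
      ∀ (μ₀ : Measure (GaugeConfig d L (Matrix.specialUnitaryGroup (Fin N) ℂ))) [IsProbabilityMeasure μ₀]
        [IsProbabilityMeasure (Kernel.trajMeasure (X := fun _ : ℕ => GaugeConfig d L (Matrix.specialUnitaryGroup (Fin N) ℂ)) μ₀
          (fun t : ℕ => (wilsonJitterHMCL N d L β nstep (uniformJitterLaw τ j)).comap
            (fun h : (i : ↥(Finset.Iic t)) → GaugeConfig d L (Matrix.specialUnitaryGroup (Fin N) ℂ) =>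
              h ⟨t, Finset.mem_Iic.2 le_rfl⟩) (measurable_pi_apply _)))]
        {Ω' : Type} [MeasurableSpace Ω'] (P' : Measure Ω') [IsProbabilityMeasure P'] (Y : Ω' → ℝ),
        HasLaw Y (gaussianReal 0 (Real.toNNReal
          ((∫ y, (f y - ∫ z, f z ∂(wilsonMeasure (d := d) (L := L) (fundamentalRep (Fin N)) (β / N))) ^ 2 ∂(wilsonMeasure (d := d) (L := L) (fundamentalRep (Fin N)) (β / N)))
              + 2 * ∑' k, ∫ y, (f y - ∫ z, f z ∂(wilsonMeasure (d := d) (L := L) (fundamentalRep (Fin N)) (β / N)))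
                * (Scoring.kop (wilsonJitterHMCL N d L β nstep (uniformJitterLaw τ j)))^[k + 1]
                  (fun y => f y - ∫ z, f z ∂(wilsonMeasure (d := d) (L := L) (fundamentalRep (Fin N)) (β / N))) y ∂(wilsonMeasure (d := d) (L := L) (fundamentalRep (Fin N)) (β / N))))) P' →
        TendstoInDistribution (fun (n : ℕ) (x : ℕ → GaugeConfig d L (Matrix.specialUnitaryGroup (Fin N) ℂ)) =>
            (Real.sqrt n)⁻¹ * ∑ t ∈ Finset.range n, (f (x t) - ∫ z, f z ∂(wilsonMeasure (d := d) (L := L) (fundamentalRep (Fin N)) (β / N))))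
          atTop Y (fun _ => (Kernel.trajMeasure (X := fun _ : ℕ => GaugeConfig d L (Matrix.specialUnitaryGroup (Fin N) ℂ)) μ₀
              (fun t : ℕ => (wilsonJitterHMCL N d L β nstep (uniformJitterLaw τ j)).comap
                (fun h : (i : ↥(Finset.Iic t)) → GaugeConfig d L (Matrix.specialUnitaryGroup (Fin N) ℂ) =>
                  h ⟨t, Finset.mem_Iic.2 le_rfl⟩) (measurable_pi_apply _)))) P' := by
  obtain ⟨τ₀, hτ₀, h⟩ := wilson_uniformJitterHMC_certificate (N := N) (d := d) (L := L) β
  refine ⟨τ₀, hτ₀, fun nstep τ j hn hτ hj hj1 hshort f hf C hC μ₀ _ _ Ω' _ P' _ Y hY => ?_⟩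
  obtain ⟨m, ε', hm, hε0, -, hmin⟩ := h nstep τ j hn hτ hj hj1 hshort
  exact GeneralNCMC.tendstoInDistribution_timeAverage_of_nHit
    (wilson_uniformJitterHMC_invariant (N := N) (d := d) (L := L) β nstep τ j) hε0.ne' hmin hm hf hC μ₀ hY

/-- **BATCH MEANS ESTIMATE `σ²_f` CONSISTENTLY ALONG THE ENGINE'S JITTERED `SU(N)` HMC, FROM EVERY INITIAL LAW**:
`a b · SE²_BM → σ²_f` in probability as the number of batches `a` and the batch length `b` go to infinity. -/
theorem wilson_uniformJitterHMC_batchMeans_tendstoInMeasure :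
    ∃ τ₀ : ℝ, 0 < τ₀ ∧ ∀ (nstep : ℕ) (τ j : ℝ), 1 ≤ nstep → 0 < τ → 0 < j → j ≤ 1 → τ * (1 - j) < τ₀ →
      ∀ (f : GaugeConfig d L (Matrix.specialUnitaryGroup (Fin N) ℂ) → ℝ), Measurable f → ∀ C : ℝ, (∀ U, |f U| ≤ C) →
      ∀ (μ₀ : Measure (GaugeConfig d L (Matrix.specialUnitaryGroup (Fin N) ℂ))) [IsProbabilityMeasure μ₀] (a b' : ℕ → ℕ),
        Tendsto a atTop atTop → Tendsto b' atTop atTop →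
        TendstoInMeasure (Kernel.trajMeasure (X := fun _ : ℕ => GaugeConfig d L (Matrix.specialUnitaryGroup (Fin N) ℂ)) μ₀
              (fun t : ℕ => (wilsonJitterHMCL N d L β nstep (uniformJitterLaw τ j)).comap
                (fun h : (i : ↥(Finset.Iic t)) → GaugeConfig d L (Matrix.specialUnitaryGroup (Fin N) ℂ) =>
                  h ⟨t, Finset.mem_Iic.2 le_rfl⟩) (measurable_pi_apply _)))
          (fun (n : ℕ) (x : ℕ → GaugeConfig d L (Matrix.specialUnitaryGroup (Fin N) ℂ)) => ((b' n * a n : ℕ) : ℝ)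
            * replicaSEsq (fun j (x : ℕ → GaugeConfig d L (Matrix.specialUnitaryGroup (Fin N) ℂ)) =>
                (∑ i ∈ Finset.range (b' n), f (x (b' n * j + i))) / (b' n)) (a n) x)
          atTop (fun _ => (∫ y, (f y - ∫ z, f z ∂(wilsonMeasure (d := d) (L := L) (fundamentalRep (Fin N)) (β / N))) ^ 2 ∂(wilsonMeasure (d := d) (L := L) (fundamentalRep (Fin N)) (β / N)))
              + 2 * ∑' k, ∫ y, (f y - ∫ z, f z ∂(wilsonMeasure (d := d) (L := L) (fundamentalRep (Fin N)) (β / N)))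
                * (Scoring.kop (wilsonJitterHMCL N d L β nstep (uniformJitterLaw τ j)))^[k + 1]
                  (fun y => f y - ∫ z, f z ∂(wilsonMeasure (d := d) (L := L) (fundamentalRep (Fin N)) (β / N))) y ∂(wilsonMeasure (d := d) (L := L) (fundamentalRep (Fin N)) (β / N))) := by
  obtain ⟨τ₀, hτ₀, h⟩ := wilson_uniformJitterHMC_certificate (N := N) (d := d) (L := L) β
  refine ⟨τ₀, hτ₀, fun nstep τ j hn hτ hj hj1 hshort f hf C hC μ₀ _ a b' ha hb' => ?_⟩
  obtain ⟨m, ε', hm, hε0, hε1, hmin⟩ := h nstep τ j hn hτ hj hj1 hshort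
  exact Scoring.chain_batchMeans_sigmaHat_tendstoInMeasure_of_nHit
    (wilson_uniformJitterHMC_invariant (N := N) (d := d) (L := L) β nstep τ j)
    (GeneralNCMC.minorised_setwise hmin) hε0 hε1 hm hf hC μ₀ ha hb'

/-- **THE BATCH-MEANS INTERVAL OF A JITTERED-HMC RUN IS ASYMPTOTICALLY EXACT** (`σ²_f > 0`, `a, b → ∞`, any
initial law, `z > 0`): `P_{μ₀}(|√(ab) (f̄_{ab} − π f)| ≤ z σ̂_BM) → (gaussianReal 0 1)[−z, z]`. -/
theorem wilson_uniformJitterHMC_batchMeans_coverage :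
    ∃ τ₀ : ℝ, 0 < τ₀ ∧ ∀ (nstep : ℕ) (τ j : ℝ), 1 ≤ nstep → 0 < τ → 0 < j → j ≤ 1 → τ * (1 - j) < τ₀ →
      ∀ (f : GaugeConfig d L (Matrix.specialUnitaryGroup (Fin N) ℂ) → ℝ), Measurable f → ∀ C : ℝ, (∀ U, |f U| ≤ C) →
        0 < (∫ y, (f y - ∫ z, f z ∂(wilsonMeasure (d := d) (L := L) (fundamentalRep (Fin N)) (β / N))) ^ 2 ∂(wilsonMeasure (d := d) (L := L) (fundamentalRep (Fin N)) (β / N)))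
              + 2 * ∑' k, ∫ y, (f y - ∫ z, f z ∂(wilsonMeasure (d := d) (L := L) (fundamentalRep (Fin N)) (β / N)))
                * (Scoring.kop (wilsonJitterHMCL N d L β nstep (uniformJitterLaw τ j)))^[k + 1]
                  (fun y => f y - ∫ z, f z ∂(wilsonMeasure (d := d) (L := L) (fundamentalRep (Fin N)) (β / N))) y ∂(wilsonMeasure (d := d) (L := L) (fundamentalRep (Fin N)) (β / N)) →
      ∀ (μ₀ : Measure (GaugeConfig d L (Matrix.specialUnitaryGroup (Fin N) ℂ))) [IsProbabilityMeasure μ₀] (a b' : ℕ → ℕ),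
        Tendsto a atTop atTop → Tendsto b' atTop atTop → ∀ z : ℝ, 0 < z →
        Tendsto (fun n : ℕ => (Kernel.trajMeasure (X := fun _ : ℕ => GaugeConfig d L (Matrix.specialUnitaryGroup (Fin N) ℂ)) μ₀
              (fun t : ℕ => (wilsonJitterHMCL N d L β nstep (uniformJitterLaw τ j)).comap
                (fun h : (i : ↥(Finset.Iic t)) → GaugeConfig d L (Matrix.specialUnitaryGroup (Fin N) ℂ) =>
                  h ⟨t, Finset.mem_Iic.2 le_rfl⟩) (measurable_pi_apply _))).real
          {x | |((Real.sqrt ((b' n * a n : ℕ) : ℝ))⁻¹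
              * ∑ t ∈ Finset.range (b' n * a n), (f (x t) - ∫ z, f z ∂(wilsonMeasure (d := d) (L := L) (fundamentalRep (Fin N)) (β / N))))
            / Real.sqrt (((b' n * a n : ℕ) : ℝ)
              * replicaSEsq (fun j (x : ℕ → GaugeConfig d L (Matrix.specialUnitaryGroup (Fin N) ℂ)) =>
                  (∑ i ∈ Finset.range (b' n), f (x (b' n * j + i))) / (b' n)) (a n) x)| ≤ z})
          atTop (𝓝 ((gaussianReal 0 1).real (Set.Icc (-z) z))) := by
  obtain ⟨τ₀, hτ₀, h⟩ := wilson_uniformJitterHMC_certificate (N := N) (d := d) (L := L) β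
  refine ⟨τ₀, hτ₀, fun nstep τ j hn hτ hj hj1 hshort f hf C hC hσ μ₀ _ a b' ha hb' z hz => ?_⟩
  obtain ⟨m, ε', hm, hε0, hε1, hmin⟩ := h nstep τ j hn hτ hj hj1 hshort
  exact Scoring.doeblinPower_batchMeans_studentized_coverage
    (wilson_uniformJitterHMC_invariant (N := N) (d := d) (L := L) β nstep τ j) hmin hε0 hε1 hm hf hC hσ μ₀ ha hb' hz

/-- **THE REPORTED `τ̂_int = σ̂²_BM/(2 v̂)` OF A JITTERED-HMC RUN IS CONSISTENT** (`Var_π f ≠ 0`, `a, b → ∞`, any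
initial law): `σ̂²/(2 v̂) → τ_int(ρ_f)` in probability, `ρ_f(t) = C_f(t)/C_f(0)` the normalised autocorrelation
function of `f` in equilibrium and `τ_int` the scorers' `1/2 + Σ_{t≥1} ρ_f(t)`. -/
theorem wilson_uniformJitterHMC_tauInt_tendstoInMeasure :
    ∃ τ₀ : ℝ, 0 < τ₀ ∧ ∀ (nstep : ℕ) (τ j : ℝ), 1 ≤ nstep → 0 < τ → 0 < j → j ≤ 1 → τ * (1 - j) < τ₀ →
      ∀ (f : GaugeConfig d L (Matrix.specialUnitaryGroup (Fin N) ℂ) → ℝ), Measurable f → ∀ C : ℝ, (∀ U, |f U| ≤ C) →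
        autocov (wilsonJitterHMCL N d L β nstep (uniformJitterLaw τ j)) (wilsonMeasure (d := d) (L := L) (fundamentalRep (Fin N)) (β / N))
          (fun y => f y - ∫ z, f z ∂(wilsonMeasure (d := d) (L := L) (fundamentalRep (Fin N)) (β / N))) 0 ≠ 0 →
      ∀ (μ₀ : Measure (GaugeConfig d L (Matrix.specialUnitaryGroup (Fin N) ℂ))) [IsProbabilityMeasure μ₀] (a b' : ℕ → ℕ),
        Tendsto a atTop atTop → Tendsto b' atTop atTop →
        TendstoInMeasure (Kernel.trajMeasure (X := fun _ : ℕ => GaugeConfig d L (Matrix.specialUnitaryGroup (Fin N) ℂ)) μ₀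
              (fun t : ℕ => (wilsonJitterHMCL N d L β nstep (uniformJitterLaw τ j)).comap
                (fun h : (i : ↥(Finset.Iic t)) → GaugeConfig d L (Matrix.specialUnitaryGroup (Fin N) ℂ) =>
                  h ⟨t, Finset.mem_Iic.2 le_rfl⟩) (measurable_pi_apply _)))
          (fun (n : ℕ) (x : ℕ → GaugeConfig d L (Matrix.specialUnitaryGroup (Fin N) ℂ)) =>
            (((b' n * a n : ℕ) : ℝ)
              * replicaSEsq (fun j (x : ℕ → GaugeConfig d L (Matrix.specialUnitaryGroup (Fin N) ℂ)) =>
                  (∑ i ∈ Finset.range (b' n), f (x (b' n * j + i))) / (b' n)) (a n) x)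
            / (2 * ((∑ t ∈ Finset.range (b' n * a n), f (x t) ^ 2) / ((b' n * a n : ℕ) : ℝ)
                - ((∑ t ∈ Finset.range (b' n * a n), f (x t)) / ((b' n * a n : ℕ) : ℝ)) ^ 2)))
          atTop (fun _ => tauInt (fun t =>
            autocov (wilsonJitterHMCL N d L β nstep (uniformJitterLaw τ j)) (wilsonMeasure (d := d) (L := L) (fundamentalRep (Fin N)) (β / N))
                (fun y => f y - ∫ z, f z ∂(wilsonMeasure (d := d) (L := L) (fundamentalRep (Fin N)) (β / N))) t
              / autocov (wilsonJitterHMCL N d L β nstep (uniformJitterLaw τ j)) (wilsonMeasure (d := d) (L := L) (fundamentalRep (Fin N)) (β / N))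
                (fun y => f y - ∫ z, f z ∂(wilsonMeasure (d := d) (L := L) (fundamentalRep (Fin N)) (β / N))) 0)) := by
  obtain ⟨τ₀, hτ₀, h⟩ := wilson_uniformJitterHMC_certificate (N := N) (d := d) (L := L) β
  refine ⟨τ₀, hτ₀, fun nstep τ j hn hτ hj hj1 hshort f hf C hC hvar μ₀ _ a b' ha hb' => ?_⟩
  obtain ⟨m, ε', hm, hε0, hε1, hmin⟩ := h nstep τ j hn hτ hj hj1 hshort
  exact Scoring.chain_batchMeans_tauInt_tendstoInMeasure_of_nHit
    (wilson_uniformJitterHMC_invariant (N := N) (d := d) (L := L) β nstep τ j) hmin hε0 hε1 hm hf hC hvar μ₀ ha hb'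

/-! ## The jittered engine HMC followed by ANY exact step (e.g. the `'hmc' + n_or × 'or'` composite as run) -/

/-- **THE CLT FOR TIME AVERAGES OF THE COMPOSITE `P ∘ K_jit`, FROM EVERY INITIAL LAW** — `P` ANY Markov kernel
leaving `wilsonMeasure (β/N)` invariant (any schedule of Cabibbo–Marinari over-relaxation hits, heat-bath sweeps,
…); `|f| ≤ C` measurable, `Y ~ N(0, σ²_f)` (the composite's Green–Kubo variance). -/
theorem wilson_uniformJitterHMC_exactStep_timeAverage_clt :
    ∃ τ₀ : ℝ, 0 < τ₀ ∧ ∀ (nstep : ℕ) (τ j : ℝ), 1 ≤ nstep → 0 < τ → 0 < j → j ≤ 1 → τ * (1 - j) < τ₀ →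
      ∀ (P : Kernel (GaugeConfig d L (Matrix.specialUnitaryGroup (Fin N) ℂ)) (GaugeConfig d L (Matrix.specialUnitaryGroup (Fin N) ℂ)))
        [IsMarkovKernel P], Invariant P (wilsonMeasure (d := d) (L := L) (fundamentalRep (Fin N)) (β / N)) →
      ∀ (f : GaugeConfig d L (Matrix.specialUnitaryGroup (Fin N) ℂ) → ℝ), Measurable f → ∀ C : ℝ, (∀ U, |f U| ≤ C) →
      ∀ (μ₀ : Measure (GaugeConfig d L (Matrix.specialUnitaryGroup (Fin N) ℂ))) [IsProbabilityMeasure μ₀]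
        [IsProbabilityMeasure (Kernel.trajMeasure (X := fun _ : ℕ => GaugeConfig d L (Matrix.specialUnitaryGroup (Fin N) ℂ)) μ₀
          (fun t : ℕ => (P ∘ₖ wilsonJitterHMCL N d L β nstep (uniformJitterLaw τ j)).comap
            (fun h : (i : ↥(Finset.Iic t)) → GaugeConfig d L (Matrix.specialUnitaryGroup (Fin N) ℂ) =>
              h ⟨t, Finset.mem_Iic.2 le_rfl⟩) (measurable_pi_apply _)))]
        {Ω' : Type} [MeasurableSpace Ω'] (P' : Measure Ω') [IsProbabilityMeasure P'] (Y : Ω' → ℝ),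
        HasLaw Y (gaussianReal 0 (Real.toNNReal
          ((∫ y, (f y - ∫ z, f z ∂(wilsonMeasure (d := d) (L := L) (fundamentalRep (Fin N)) (β / N))) ^ 2 ∂(wilsonMeasure (d := d) (L := L) (fundamentalRep (Fin N)) (β / N)))
              + 2 * ∑' k, ∫ y, (f y - ∫ z, f z ∂(wilsonMeasure (d := d) (L := L) (fundamentalRep (Fin N)) (β / N)))
                * (Scoring.kop (P ∘ₖ wilsonJitterHMCL N d L β nstep (uniformJitterLaw τ j)))^[k + 1]
                  (fun y => f y - ∫ z, f z ∂(wilsonMeasure (d := d) (L := L) (fundamentalRep (Fin N)) (β / N))) y ∂(wilsonMeasure (d := d) (L := L) (fundamentalRep (Fin N)) (β / N))))) P' →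
        TendstoInDistribution (fun (n : ℕ) (x : ℕ → GaugeConfig d L (Matrix.specialUnitaryGroup (Fin N) ℂ)) =>
            (Real.sqrt n)⁻¹ * ∑ t ∈ Finset.range n, (f (x t) - ∫ z, f z ∂(wilsonMeasure (d := d) (L := L) (fundamentalRep (Fin N)) (β / N))))
          atTop Y (fun _ => (Kernel.trajMeasure (X := fun _ : ℕ => GaugeConfig d L (Matrix.specialUnitaryGroup (Fin N) ℂ)) μ₀
              (fun t : ℕ => (P ∘ₖ wilsonJitterHMCL N d L β nstep (uniformJitterLaw τ j)).comap
                (fun h : (i : ↥(Finset.Iic t)) → GaugeConfig d L (Matrix.specialUnitaryGroup (Fin N) ℂ) =>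
                  h ⟨t, Finset.mem_Iic.2 le_rfl⟩) (measurable_pi_apply _)))) P' := by
  obtain ⟨τ₀, hτ₀, h⟩ := wilson_uniformJitterHMC_exactStep_certificate (N := N) (d := d) (L := L) β
  refine ⟨τ₀, hτ₀, fun nstep τ j hn hτ hj hj1 hshort P _ hP f hf C hC μ₀ _ _ Ω' _ P' _ Y hY => ?_⟩
  obtain ⟨hinv, m, ε', hm, hε0, -, hmin⟩ := h nstep τ j hn hτ hj hj1 hshort P hP
  exact GeneralNCMC.tendstoInDistribution_timeAverage_of_nHit hinv hε0.ne' hmin hm hf hC μ₀ hY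

/-- **THE BATCH-MEANS INTERVAL OF A COMPOSITE `P ∘ K_jit` RUN IS ASYMPTOTICALLY EXACT** (`P` ANY Markov kernel
leaving `wilsonMeasure (β/N)` invariant; `σ²_f > 0`, `a, b → ∞`, any initial law, `z > 0`):
`P_{μ₀}(|√(ab) (f̄_{ab} − π f)| ≤ z σ̂_BM) → (gaussianReal 0 1)[−z, z]`. -/
theorem wilson_uniformJitterHMC_exactStep_batchMeans_coverage :
    ∃ τ₀ : ℝ, 0 < τ₀ ∧ ∀ (nstep : ℕ) (τ j : ℝ), 1 ≤ nstep → 0 < τ → 0 < j → j ≤ 1 → τ * (1 - j) < τ₀ →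
      ∀ (P : Kernel (GaugeConfig d L (Matrix.specialUnitaryGroup (Fin N) ℂ)) (GaugeConfig d L (Matrix.specialUnitaryGroup (Fin N) ℂ)))
        [IsMarkovKernel P], Invariant P (wilsonMeasure (d := d) (L := L) (fundamentalRep (Fin N)) (β / N)) →
      ∀ (f : GaugeConfig d L (Matrix.specialUnitaryGroup (Fin N) ℂ) → ℝ), Measurable f → ∀ C : ℝ, (∀ U, |f U| ≤ C) →
        0 < (∫ y, (f y - ∫ z, f z ∂(wilsonMeasure (d := d) (L := L) (fundamentalRep (Fin N)) (β / N))) ^ 2 ∂(wilsonMeasure (d := d) (L := L) (fundamentalRep (Fin N)) (β / N)))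
              + 2 * ∑' k, ∫ y, (f y - ∫ z, f z ∂(wilsonMeasure (d := d) (L := L) (fundamentalRep (Fin N)) (β / N)))
                * (Scoring.kop (P ∘ₖ wilsonJitterHMCL N d L β nstep (uniformJitterLaw τ j)))^[k + 1]
                  (fun y => f y - ∫ z, f z ∂(wilsonMeasure (d := d) (L := L) (fundamentalRep (Fin N)) (β / N))) y ∂(wilsonMeasure (d := d) (L := L) (fundamentalRep (Fin N)) (β / N)) →
      ∀ (μ₀ : Measure (GaugeConfig d L (Matrix.specialUnitaryGroup (Fin N) ℂ))) [IsProbabilityMeasure μ₀] (a b' : ℕ → ℕ),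
        Tendsto a atTop atTop → Tendsto b' atTop atTop → ∀ z : ℝ, 0 < z →
        Tendsto (fun n : ℕ => (Kernel.trajMeasure (X := fun _ : ℕ => GaugeConfig d L (Matrix.specialUnitaryGroup (Fin N) ℂ)) μ₀
              (fun t : ℕ => (P ∘ₖ wilsonJitterHMCL N d L β nstep (uniformJitterLaw τ j)).comap
                (fun h : (i : ↥(Finset.Iic t)) → GaugeConfig d L (Matrix.specialUnitaryGroup (Fin N) ℂ) =>
                  h ⟨t, Finset.mem_Iic.2 le_rfl⟩) (measurable_pi_apply _))).real
          {x | |((Real.sqrt ((b' n * a n : ℕ) : ℝ))⁻¹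
              * ∑ t ∈ Finset.range (b' n * a n), (f (x t) - ∫ z, f z ∂(wilsonMeasure (d := d) (L := L) (fundamentalRep (Fin N)) (β / N))))
            / Real.sqrt (((b' n * a n : ℕ) : ℝ)
              * replicaSEsq (fun j (x : ℕ → GaugeConfig d L (Matrix.specialUnitaryGroup (Fin N) ℂ)) =>
                  (∑ i ∈ Finset.range (b' n), f (x (b' n * j + i))) / (b' n)) (a n) x)| ≤ z})
          atTop (𝓝 ((gaussianReal 0 1).real (Set.Icc (-z) z))) := by
  obtain ⟨τ₀, hτ₀, h⟩ := wilson_uniformJitterHMC_exactStep_certificate (N := N) (d := d) (L := L) β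
  refine ⟨τ₀, hτ₀, fun nstep τ j hn hτ hj hj1 hshort P _ hP f hf C hC hσ μ₀ _ a b' ha hb' z hz => ?_⟩
  obtain ⟨hinv, m, ε', hm, hε0, hε1, hmin⟩ := h nstep τ j hn hτ hj hj1 hshort P hP
  exact Scoring.doeblinPower_batchMeans_studentized_coverage hinv hmin hε0 hε1 hm hf hC hσ μ₀ ha hb' hz

end ErrorBars

/-! ## From `EngineTauIntErrorBars.lean` (GEN-23, atom version) — the uniform-law twin -/

section UniformJitter

variable {N d L : ℕ} [NeZero N] [NeZero L] (β : ℝ)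

/-- **`τ̂ (1 ± z √(2/a))` COVERS `τ_int` WITH PROBABILITY `→ N(0,1)([−z, z])` — JITTERED ENGINE HMC, EVERY START.**
There is `τ₀ > 0` (depending on `N, d, L, β` only) such that whenever `nstep ≥ 1`, `τ > 0`,
`0 < j ≤ 1` and `τ(1 − j) < τ₀`: for `|f| ≤ C` measurable with `Var_π f ≠ 0` and `σ²_f > 0`, every
initial law `μ₀`, all `a_n, b_n → ∞` with `a_n/b_n² → 0` and every `z`,
`P_{μ₀}(|√a_n (τ̂_n − τ_int)| ≤ z √2 τ̂_n) → N(0,1)([−z, z])`. -/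
theorem wilson_uniformJitterHMC_tauInt_interval_coverage :
    ∃ τ₀ : ℝ, 0 < τ₀ ∧ ∀ (nstep : ℕ) (τ j : ℝ), 1 ≤ nstep → 0 < τ → 0 < j → j ≤ 1 → τ * (1 - j) < τ₀ →
      ∀ (f : GaugeConfig d L (Matrix.specialUnitaryGroup (Fin N) ℂ) → ℝ), Measurable f → ∀ C : ℝ, (∀ U, |f U| ≤ C) →
        autocov (wilsonJitterHMCL N d L β nstep (uniformJitterLaw τ j))
              (wilsonMeasure (d := d) (L := L) (fundamentalRep (Fin N)) (β / N))
              (fun y => f y - ∫ z, f z ∂(wilsonMeasure (d := d) (L := L) (fundamentalRep (Fin N)) (β / N))) 0 ≠ 0 →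
        0 < ((∫ y, (f y - ∫ z, f z ∂(wilsonMeasure (d := d) (L := L) (fundamentalRep (Fin N)) (β / N))) ^ 2
              ∂(wilsonMeasure (d := d) (L := L) (fundamentalRep (Fin N)) (β / N)))
          + 2 * ∑' k, ∫ y, (f y - ∫ z, f z ∂(wilsonMeasure (d := d) (L := L) (fundamentalRep (Fin N)) (β / N)))
            * (kop (wilsonJitterHMCL N d L β nstep (uniformJitterLaw τ j)))^[k + 1]
              (fun y => f y - ∫ z, f z ∂(wilsonMeasure (d := d) (L := L) (fundamentalRep (Fin N)) (β / N))) y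
                ∂(wilsonMeasure (d := d) (L := L) (fundamentalRep (Fin N)) (β / N))) →
      ∀ (μ₀ : Measure (GaugeConfig d L (Matrix.specialUnitaryGroup (Fin N) ℂ))) [IsProbabilityMeasure μ₀] (a b : ℕ → ℕ),
        Tendsto a atTop atTop → Tendsto b atTop atTop → Tendsto (fun n => (a n : ℝ) / (b n : ℝ) ^ 2) atTop (𝓝 0) →
      ∀ [IsProbabilityMeasure (Kernel.trajMeasure (X := fun _ : ℕ => GaugeConfig d L (Matrix.specialUnitaryGroup (Fin N) ℂ)) μ₀
          (fun n : ℕ => (wilsonJitterHMCL N d L β nstep (uniformJitterLaw τ j)).comap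
              (fun h' : (i : ↥(Finset.Iic n))
                → GaugeConfig d L (Matrix.specialUnitaryGroup (Fin N) ℂ) => h' ⟨n, Finset.mem_Iic.2 le_rfl⟩)
            (measurable_pi_apply _)))] (z : ℝ),
        Tendsto (fun n : ℕ => ((Kernel.trajMeasure (X := fun _ : ℕ => GaugeConfig d L (Matrix.specialUnitaryGroup (Fin N) ℂ)) μ₀
              (fun n : ℕ => (wilsonJitterHMCL N d L β nstep (uniformJitterLaw τ j)).comap
              (fun h' : (i : ↥(Finset.Iic n))
                → GaugeConfig d L (Matrix.specialUnitaryGroup (Fin N) ℂ) => h' ⟨n, Finset.mem_Iic.2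
                    le_rfl⟩)
                (measurable_pi_apply _)))).real
          {x | |Real.sqrt (a n) * ((((b n * a n : ℕ) : ℝ) * replicaSEsq
              (fun j (x : ℕ → GaugeConfig d L (Matrix.specialUnitaryGroup (Fin N) ℂ)) => (∑ i ∈
                Finset.range (b n), f (x (b n * j + i))) / (b n)) (a n) x) / (2 * ((∑ t ∈ Finset.range
                (b n * a n), f (x t) ^ 2) / ((b n * a n : ℕ) : ℝ) - ((∑ t ∈ Finset.range (b n * a n), f
                (x t)) / ((b n * a n : ℕ) : ℝ)) ^ 2))
              - tauInt (fun t => autocov (wilsonJitterHMCL N d L β nstep (uniformJitterLaw τ j))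
              (wilsonMeasure (d := d) (L := L) (fundamentalRep (Fin N)) (β / N))
              (fun y => f y - ∫ z, f z ∂(wilsonMeasure (d := d) (L := L) (fundamentalRep (Fin N)) (β / N))) t
                  / autocov (wilsonJitterHMCL N d L β nstep (uniformJitterLaw τ j))
              (wilsonMeasure (d := d) (L := L) (fundamentalRep (Fin N)) (β / N))
              (fun y => f y - ∫ z, f z ∂(wilsonMeasure (d := d) (L := L) (fundamentalRep (Fin N)) (β / N))) 0))
            / (Real.sqrt 2 * ((((b n * a n : ℕ) : ℝ) * replicaSEsq
              (fun j (x : ℕ → GaugeConfig d L (Matrix.specialUnitaryGroup (Fin N) ℂ)) => (∑ i ∈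
                  Finset.range (b n), f (x (b n * j + i))) / (b n)) (a n) x) / (2 * ((∑ t ∈
                  Finset.range (b n * a n), f (x t) ^ 2) / ((b n * a n : ℕ) : ℝ) - ((∑ t ∈ Finset.range
                  (b n * a n), f (x t)) / ((b n * a n : ℕ) : ℝ)) ^ 2))))| ≤ z})
          atTop (𝓝 ((gaussianReal 0 1).real (Set.Icc (-z) z))) := by
  obtain ⟨τ₀, hτ₀, h⟩ := wilson_uniformJitterHMC_certificate (N := N) (d := d) (L := L) β
  refine ⟨τ₀, hτ₀, fun nstep τ j hn hτ hj hj1 hshort f hf C hC hvar hσ μ₀ _ a b ha hb hab _ z => ?_⟩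
  obtain ⟨m, ε', hm, hε0, hε1, hmin⟩ := h nstep τ j hn hτ hj hj1 hshort
  obtain ⟨A, ρ, hA, hρ0, hρ1, henv⟩ := Scoring.exists_geometricEnvelope_of_nHit (GeneralNCMC.minorised_setwise hmin)
    hε0 hε1 hm (wilson_uniformJitterHMC_invariant (N := N) (d := d) (L := L) β nstep τ j)
  have hY : HasLaw (fun t : ℝ => t) (gaussianReal 0 1) (gaussianReal 0 1) := ⟨aemeasurable_id', Measure.map_id'⟩
  exact Scoring.CardConsistency.tendsto_measureReal_abs_le_gaussian
    (Scoring.chain_batchMeans_tauInt_studentized_clt_of_envelope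
      (wilson_uniformJitterHMC_invariant (N := N) (d := d) (L := L) β nstep τ j) henv hA hρ0 hρ1 hf hC hvar hσ μ₀ ha hb hab hY)
    hY z

/-! ## §2 The jittered `'hmc'` path followed by ANY exact step -/

/-- **THE SAME FOR THE COMPOSITE `P ∘ K_jit`** — `P` ANY Markov kernel leaving `wilsonMeasure (β/N)` invariant. -/
theorem wilson_uniformJitterHMC_exactStep_tauInt_interval_coverage :
    ∃ τ₀ : ℝ, 0 < τ₀ ∧ ∀ (nstep : ℕ) (τ j : ℝ), 1 ≤ nstep → 0 < τ → 0 < j → j ≤ 1 → τ * (1 - j) < τ₀ →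
      ∀ (P : Kernel (GaugeConfig d L (Matrix.specialUnitaryGroup (Fin N) ℂ)) (GaugeConfig d L (Matrix.specialUnitaryGroup (Fin N) ℂ)))
        [IsMarkovKernel P], Invariant P (wilsonMeasure (d := d) (L := L) (fundamentalRep (Fin N)) (β / N)) →
      ∀ (f : GaugeConfig d L (Matrix.specialUnitaryGroup (Fin N) ℂ) → ℝ), Measurable f → ∀ C : ℝ, (∀ U, |f U| ≤ C) →
        autocov (P ∘ₖ wilsonJitterHMCL N d L β nstep (uniformJitterLaw τ j))
              (wilsonMeasure (d := d) (L := L) (fundamentalRep (Fin N)) (β / N))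
              (fun y => f y - ∫ z, f z ∂(wilsonMeasure (d := d) (L := L) (fundamentalRep (Fin N)) (β / N))) 0 ≠ 0 →
        0 < ((∫ y, (f y - ∫ z, f z ∂(wilsonMeasure (d := d) (L := L) (fundamentalRep (Fin N)) (β / N))) ^ 2
              ∂(wilsonMeasure (d := d) (L := L) (fundamentalRep (Fin N)) (β / N)))
          + 2 * ∑' k, ∫ y, (f y - ∫ z, f z ∂(wilsonMeasure (d := d) (L := L) (fundamentalRep (Fin N)) (β / N)))
            * (kop (P ∘ₖ wilsonJitterHMCL N d L β nstep (uniformJitterLaw τ j)))^[k + 1]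
              (fun y => f y - ∫ z, f z ∂(wilsonMeasure (d := d) (L := L) (fundamentalRep (Fin N)) (β / N))) y
                ∂(wilsonMeasure (d := d) (L := L) (fundamentalRep (Fin N)) (β / N))) →
      ∀ (μ₀ : Measure (GaugeConfig d L (Matrix.specialUnitaryGroup (Fin N) ℂ))) [IsProbabilityMeasure μ₀] (a b : ℕ → ℕ),
        Tendsto a atTop atTop → Tendsto b atTop atTop → Tendsto (fun n => (a n : ℝ) / (b n : ℝ) ^ 2) atTop (𝓝 0) →
      ∀ [IsProbabilityMeasure (Kernel.trajMeasure (X := fun _ : ℕ => GaugeConfig d L (Matrix.specialUnitaryGroup (Fin N) ℂ)) μ₀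
          (fun n : ℕ => (P ∘ₖ wilsonJitterHMCL N d L β nstep (uniformJitterLaw τ j)).comap
              (fun h' : (i : ↥(Finset.Iic n))
                → GaugeConfig d L (Matrix.specialUnitaryGroup (Fin N) ℂ) => h' ⟨n, Finset.mem_Iic.2 le_rfl⟩)
            (measurable_pi_apply _)))] (z : ℝ),
        Tendsto (fun n : ℕ => ((Kernel.trajMeasure (X := fun _ : ℕ => GaugeConfig d L (Matrix.specialUnitaryGroup (Fin N) ℂ)) μ₀
              (fun n : ℕ => (P ∘ₖ wilsonJitterHMCL N d L β nstep (uniformJitterLaw τ j)).comap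
              (fun h' : (i : ↥(Finset.Iic n))
                → GaugeConfig d L (Matrix.specialUnitaryGroup (Fin N) ℂ) => h' ⟨n, Finset.mem_Iic.2
                    le_rfl⟩)
                (measurable_pi_apply _)))).real
          {x | |Real.sqrt (a n) * ((((b n * a n : ℕ) : ℝ) * replicaSEsq
              (fun j (x : ℕ → GaugeConfig d L (Matrix.specialUnitaryGroup (Fin N) ℂ)) => (∑ i ∈
                Finset.range (b n), f (x (b n * j + i))) / (b n)) (a n) x) / (2 * ((∑ t ∈ Finset.range
                (b n * a n), f (x t) ^ 2) / ((b n * a n : ℕ) : ℝ) - ((∑ t ∈ Finset.range (b n * a n), f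
                (x t)) / ((b n * a n : ℕ) : ℝ)) ^ 2))
              - tauInt (fun t => autocov (P ∘ₖ wilsonJitterHMCL N d L β nstep (uniformJitterLaw τ j))
              (wilsonMeasure (d := d) (L := L) (fundamentalRep (Fin N)) (β / N))
              (fun y => f y - ∫ z, f z ∂(wilsonMeasure (d := d) (L := L) (fundamentalRep (Fin N)) (β / N))) t
                  / autocov (P ∘ₖ wilsonJitterHMCL N d L β nstep (uniformJitterLaw τ j))
              (wilsonMeasure (d := d) (L := L) (fundamentalRep (Fin N)) (β / N))
              (fun y => f y - ∫ z, f z ∂(wilsonMeasure (d := d) (L := L) (fundamentalRep (Fin N)) (β / N))) 0))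
            / (Real.sqrt 2 * ((((b n * a n : ℕ) : ℝ) * replicaSEsq
              (fun j (x : ℕ → GaugeConfig d L (Matrix.specialUnitaryGroup (Fin N) ℂ)) => (∑ i ∈
                  Finset.range (b n), f (x (b n * j + i))) / (b n)) (a n) x) / (2 * ((∑ t ∈
                  Finset.range (b n * a n), f (x t) ^ 2) / ((b n * a n : ℕ) : ℝ) - ((∑ t ∈ Finset.range
                  (b n * a n), f (x t)) / ((b n * a n : ℕ) : ℝ)) ^ 2))))| ≤ z})
          atTop (𝓝 ((gaussianReal 0 1).real (Set.Icc (-z) z))) := by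
  obtain ⟨τ₀, hτ₀, h⟩ := wilson_uniformJitterHMC_exactStep_certificate (N := N) (d := d) (L := L) β
  refine ⟨τ₀, hτ₀, fun nstep τ j hn hτ hj hj1 hshort P _ hP f hf C hC hvar hσ μ₀ _ a b ha hb hab _ z => ?_⟩
  obtain ⟨hinv, m, ε', hm, hε0, hε1, hmin⟩ := h nstep τ j hn hτ hj hj1 hshort P hP
  haveI := isMarkovKernel_wilsonJitterHMCL (N := N) (d := d) (L := L) β nstep (uniformJitterLaw τ j)
  obtain ⟨A, ρ, hA, hρ0, hρ1, henv⟩ := Scoring.exists_geometricEnvelope_of_nHit (GeneralNCMC.minorised_setwise hmin)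
    hε0 hε1 hm hinv
  have hY : HasLaw (fun t : ℝ => t) (gaussianReal 0 1) (gaussianReal 0 1) := ⟨aemeasurable_id', Measure.map_id'⟩
  exact Scoring.CardConsistency.tendsto_measureReal_abs_le_gaussian
    (Scoring.chain_batchMeans_tauInt_studentized_clt_of_envelope hinv henv hA hρ0 hρ1 hf hC hvar hσ μ₀ ha hb hab hY) hY z

end UniformJitter

end Summit.Ventures.LatticeQCDFlow.Exactness

end
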